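import Literature.AlgebraicGeometry.HodgeTheory.SmoothQuasiProjectiveComponents
import HarnessLib

/-!
# The component cofan of a smooth quasi-projective complex scheme, indexed by a locally constant invariant
# of its complex points

Family `hodge`, layer `Literature/AlgebraicGeometry/HodgeTheory`.  PROOF FILE (theorems only; no definition, no
named fact).  Sequel to ★ `HodgeTheory.exists_components_isColimit_of_smooth` (`SmoothQuasiProjectiveComponents`):
if `κ : X(ℂ) → ι` is a locally constant function on the complex points of a smooth quasi-projective `ℂ`-scheme
`X` whose fibres `κ⁻¹{i}` are all CONNECTED (in particular non-empty), then the fibres are exactly the connected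
components of `X(ℂ)` (a clopen connected set is a component), hence — by SGA1 XII Prop. 2.4 in the tree's form —
exactly the complex points of the irreducible components of `X`; re-indexing the component cofan along the
resulting bijection `ι ≃ {components}` exhibits `X` as the coproduct `∐_{i : ι} S_i` IN `SchemeOver ℂ` of open and
closed irreducible quasi-projective smooth subschemes `S_i` with `S_i(ℂ) = κ⁻¹{i}`.

* (private) `nonempty_isColimit_cofan_reindex` — a colimit cofan re-indexed along an equivalence of index types
  is a colimit cofan;
* `exists_cofan_of_isLocallyConstant_of_isConnected_fiber` — the statement above.

Use (cell hodgecm-mathlib, clause (U1) of ★ `siegelModuli_complexUniformisation`, U-DAG node U-d): with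
`X = 𝓜 ⊗_ℚ ℂ` and `κ = c` the Weil-pairing class `𝓜_ℂ(ℂ) → (ℤ/N)ˣ` (locally constant; fibres `unif_c(𝔥_g)`
connected), this is token-for-token the (U1) cofan `∃ (S : (ℤ/N)ˣ → SchemeOver ℂ) (ι : ∀ c, S c ⟶ 𝓜_ℂ), IsColimit
(Cofan.mk _ ι) ∧ ∀ c, IrreducibleSpace (S c)` together with `S_c(ℂ) = {x | c(x) = c}`.

## References
* [SGA1] A. Grothendieck, M. Raynaud, SGA 1, Exp. XII Prop. 2.4 (`X` connexe ⇔ `X^an` connexe; components).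
* [GortzWedhorn2020] U. Görtz, T. Wedhorn, *Algebraic Geometry I* (2nd ed. 2020), Exercise 3.16 (p. 117) (components of
  a smooth scheme are open and disjoint).
-/

set_option autoImplicit false

noncomputable section

open CategoryTheory CategoryTheory.Limits AlgebraicGeometry Set Function
open Literature.AlgebraicTopology.SingularHomology

namespace Literature.AlgebraicGeometry.HodgeTheory

open _root_.Topology
open Literature.AlgebraicGeometry.Motives

universe v' u'

/-- **Re-indexing a colimit cofan along an equivalence of index types gives a colimit cofan.** [folklore] -/
private theorem nonempty_isColimit_cofan_reindex {𝒞 : Type u'} [Category.{v'} 𝒞] {C ι : Type} {X : 𝒞}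
    {E : C → 𝒞} (e : ∀ c, E c ⟶ X) (hc : IsColimit (Cofan.mk X e)) (σ : ι ≃ C) :
    Nonempty (IsColimit (Cofan.mk X fun i => e (σ i))) := by
  -- transport of cofan legs along equalities of indices
  have key₁ : ∀ (t : Cofan fun i => E (σ i)) {j i : ι} (h : j = i),
      eqToHom (congrArg (fun k => E (σ k)) h.symm) ≫ t.inj j = t.inj i := by
    rintro t j _ rfl
    simp
  have key₂ : ∀ {c c' : C} (h : c' = c), eqToHom (congrArg E h.symm) ≫ e c' = e c := by
    rintro c _ rfl
    simp
  refine ⟨Cofan.IsColimit.mk _ (fun t => Cofan.IsColimit.desc hc fun c =>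
      eqToHom (congrArg E (σ.apply_symm_apply c).symm) ≫ t.inj (σ.symm c)) ?_ ?_⟩
  · intro t i
    change (Cofan.mk X e).inj (σ i) ≫ _ = _
    rw [Cofan.IsColimit.fac]
    exact key₁ t (σ.symm_apply_apply i)
  · intro t m hm
    apply Cofan.IsColimit.hom_ext hc
    intro c
    rw [Cofan.IsColimit.fac]
    change e c ≫ m = _
    rw [← key₂ (σ.apply_symm_apply c), Category.assoc]
    have hmc : e (σ (σ.symm c)) ≫ m = t.inj (σ.symm c) := hm (σ.symm c)
    rw [hmc]

variable (X : SchemeOver ℂ)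

/-- **The component cofan indexed by a locally constant invariant with connected fibres.**  Let `X` be a smooth
quasi-projective `ℂ`-scheme and `κ : X(ℂ) → ι` (`ι` finite) a locally constant function whose fibres `κ⁻¹{i}`
are all connected.  Then there are `ℂ`-schemes `S_i`, `i : ι`, with open and closed immersions `e_i : S_i ⟶ X`
over `ℂ`, each `S_i` irreducible, quasi-projective and smooth of some relative dimension over `ℂ`, with `S_i(ℂ)`
connected and `e_i(S_i(ℂ)) = κ⁻¹{i}`, such that the cofan `(e_i)_i` is a COLIMIT in `SchemeOver ℂ`
(`X ≅ ∐_i S_i`).  Proof: the fibres of `κ` are clopen and connected, hence connected components of `X(ℂ)`; by the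
tree's `exists_components_isColimit_of_smooth` (SGA1 XII Prop. 2.4 + Görtz–Wedhorn I Ex. 3.16) these are the
complex points of the irreducible components `E_c ↪ X`, `c : C`, which form a colimit cofan; matching fibres with
components is a bijection `ι ≃ C`, and a colimit cofan re-indexed along a bijection is a colimit cofan.
[cite: SGA1, Exp. XII Prop. 2.4] [cite: GortzWedhorn2020, Exercise 3.16 (p. 117)] -/
theorem exists_cofan_of_isLocallyConstant_of_isConnected_fiber [Smooth X.hom] (hX : IsQuasiProjectiveOver X)
    {ι : Type} [Finite ι] (κ : ComplexPoints X → ι) (hκ : IsLocallyConstant κ)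
    (hconn : ∀ i, IsConnected (κ ⁻¹' {i})) :
    ∃ (S : ι → SchemeOver ℂ) (e : ∀ i, S i ⟶ X),
      (∀ i, IsOpenImmersion (e i).left) ∧ (∀ i, IsClosedImmersion (e i).left) ∧
        (∀ i, IrreducibleSpace (S i).left) ∧ (∀ i, IsQuasiProjectiveOver (S i)) ∧
        (∀ i, ∃ d : ℕ, SmoothOfRelativeDimension d (S i).hom) ∧
        (∀ i, ConnectedSpace (ComplexPoints (S i))) ∧
        (∀ i, Set.range (AlgPoints.map (L := ℂ) (e i)) = κ ⁻¹' {i}) ∧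
        Nonempty (IsColimit (Cofan.mk X e)) := by
  classical
  obtain ⟨C, hfin, E, e, hopen, hclosed, hirr, hqp, hdim, hconnE, hA, hcomp, ⟨hcol⟩⟩ :=
    exists_components_isColimit_of_smooth X hX
  -- the fibres of `κ` are connected components of `X(ℂ)`
  have hfib : ∀ i, ∀ P ∈ κ ⁻¹' {i}, connectedComponent P = κ ⁻¹' {i} := fun i P hP ↦
    Subset.antisymm (IsClopen.connectedComponent_subset (hκ.isClopen_fiber i) hP)
      ((hconn i).isPreconnected.subset_connectedComponent hP)
  -- match each fibre with the component through one of its points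
  have hex : ∀ i, ∃ c, Set.range (AlgPoints.map (L := ℂ) (e c)) = κ ⁻¹' {i} := fun i ↦ by
    obtain ⟨P, hP⟩ := (hconn i).nonempty
    obtain ⟨c, hc⟩ := hA.exists_mem P
    exact ⟨c, (hcomp c P hc).symm.trans (hfib i P hP)⟩
  choose φ hφ using hex
  have hφinj : Function.Injective φ := fun i j h ↦ by
    obtain ⟨P, hP⟩ := (hconn i).nonempty
    have hPj : P ∈ κ ⁻¹' {j} := by
      rw [← hφ j, ← h, hφ i]
      exact hP
    exact (Set.mem_singleton_iff.mp (Set.mem_preimage.mp hP)).symm.trans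
      (Set.mem_singleton_iff.mp (Set.mem_preimage.mp hPj))
  have hφsurj : Function.Surjective φ := fun c ↦ by
    haveI := hconnE c
    obtain ⟨Q⟩ := (inferInstance : Nonempty (ComplexPoints (E c)))
    refine ⟨κ (AlgPoints.map (L := ℂ) (e c) Q), ?_⟩
    refine hA.eq_of_mem (z := AlgPoints.map (L := ℂ) (e c) Q) ?_ ⟨Q, rfl⟩
    rw [hφ]
    exact rfl
  let σ : ι ≃ C := Equiv.ofBijective φ ⟨hφinj, hφsurj⟩
  refine ⟨fun i => E (σ i), fun i => e (σ i), fun i => hopen _, fun i => hclosed _, fun i => hirr _,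
    fun i => hqp _, fun i => hdim _, fun i => hconnE _, fun i => hφ i, ?_⟩
  exact nonempty_isColimit_cofan_reindex e hcol σ

end Literature.AlgebraicGeometry.HodgeTheory

end
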